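import Literature.NumberTheory.Sieve.UnitPeriodizedWeight
import Literature.NumberTheory.Sieve.SmoothSmallModuli
import HarnessLib

/-!
# The smooth cube weight as a log-weight and its `U_𝔣`-periodization on `logSpace K`

Topic `Literature/NumberTheory/Sieve`, sub-namespace `UnitPeriodic` (continued). For the family
profile weights `Ω'(α) = ∏_w k_w(log σ_w α − log M)` of the smooth Bombieri–Vinogradov chain
(`SmoothTypeOne.weightΩfam`), on totally positive `α`:

* `Wcube kf M y = ∏_w k_w(y_w − log M)` — the cube weight as a function of `y = logVec α`
  (`weightΩfam_eq_Wcube`);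
* `PhiT kf M t h = Wcube kf M (ofTH (t, h))` — the weight in the `(t, h)` coordinates of
  `UnitPeriodizedWeight`; `contDiff_PhiT`; `toTH_ofTH`;
* `PhiT_eq_zero_of_norm_gt` — **uniform support**: `PhiT kf M t h = 0` once `‖h‖ > 2(log 2 − a)`, for
  profiles vanishing off `[a − log 2, 0]` (independently of `t` and `M`);
* `tsum_kerPosUnits_weightΩfam` — **`∑'_{η ∈ U_𝔣} Ω'(ηα) = periodize L_𝔣 (PhiT kf M t_α) h_α`**.

## References

* T. Mitsui, Jap. J. Math. 26 (1956), §3. [cite: Mitsui1956, §3]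
* J. Hinz, Acta Arith. 51 (1988), §2 p. 178. [cite: Hinz1988, §2 p. 178]
-/

noncomputable section

open NumberField NumberField.InfinitePlace NumberField.Units NumberField.Units.dirichletUnitTheorem
  Literature.NumberTheory.LFunctions Literature.NumberTheory.LFunctions.HeckeCone
  Literature.NumberTheory.Sieve.UnitKernel Literature.Algebra.EuclideanLattices.LatticePeriodic Module
  Literature.NumberTheory.Sieve.NumberFieldLS Literature.NumberTheory.Sieve.SmoothTypeOne
  Literature.NumberTheory.Sieve.SmoothWeights Literature.NumberTheory.Sieve.TypeTwoReparam
  Literature.NumberTheory.Sieve.TypeTwoBlock Literature.NumberTheory.Sieve.SmoothSmallModuli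
open scoped Classical

namespace Literature.NumberTheory.Sieve.UnitPeriodic

variable {K : Type*} [Field K] [NumberField K]

local notation "d" => Module.finrank ℚ K
local notation "RP" => {w : InfinitePlace K // IsReal w}

/-! ## `toTH ∘ ofTH = id` -/

/-- **`toTH (ofTH p) = p`.** [folklore] -/
theorem toTH_ofTH (p : ℝ × logSpace K) : toTH K (ofTH K p) = p := by
  have hmult : ∀ w : InfinitePlace K, (mult w : ℝ) ≠ 0 := fun w => by
    rw [mult]; split_ifs <;> norm_num
  have hd : ∑ w : InfinitePlace K, (mult w : ℝ) = d := by exact_mod_cast sum_mult_eq (K := K)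
  have hdpos : (0 : ℝ) < d := by exact_mod_cast Module.finrank_pos
  -- the weighted sum of `ofTH p` is `d · t`
  have hsum : ∑ w : InfinitePlace K, (mult w : ℝ) * ofTH K p w = d * p.1 := by
    rw [Fintype.sum_eq_add_sum_subtype_ne _ w₀]
    have h1 : ∑ w : {w : InfinitePlace K // w ≠ w₀}, (mult w.1 : ℝ) * ofTH K p w.1 =
        ∑ w : {w : InfinitePlace K // w ≠ w₀}, ((mult w.1 : ℝ) * p.1 + p.2 w) := by
      refine Finset.sum_congr rfl fun w _ => ?_
      simp only [ofTH, dif_neg w.2]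
      field_simp
    have h0 : (mult (w₀ : InfinitePlace K) : ℝ) * ofTH K p w₀ = (mult (w₀ : InfinitePlace K) : ℝ) * p.1 - ∑ w', p.2 w' := by
      have : ofTH K p w₀ = p.1 - (∑ w', p.2 w') / (mult (w₀ : InfinitePlace K) : ℝ) := by simp [ofTH]
      rw [this]
      field_simp
    rw [h1, h0, Finset.sum_add_distrib, ← Finset.sum_mul]
    have h2 : (mult (w₀ : InfinitePlace K) : ℝ) + ∑ w : {w : InfinitePlace K // w ≠ w₀}, (mult w.1 : ℝ) = d := by
      rw [← hd, Fintype.sum_eq_add_sum_subtype_ne _ w₀]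
    have h3 : ∑ w : {w : InfinitePlace K // w ≠ w₀}, (mult w.1 : ℝ) = d - mult (w₀ : InfinitePlace K) := by linarith
    rw [h3]; ring
  ext
  · simp only [toTH, hsum]
    field_simp
  · rename_i w
    simp only [toTH, hsum]
    have : (d : ℝ) * p.1 / d = p.1 := by field_simp
    rw [this]
    simp only [ofTH, dif_neg w.2]
    field_simp
    ring

/-! ## The cube weight as a log-weight -/

variable (K) in
/-- `Wcube kf M y = ∏_w k_w(y_w − log M)`. [folklore] -/
def Wcube (kf : RP → ℝ → ℝ) (M : ℝ) (y : InfinitePlace K → ℝ) : ℝ := ∏ w : RP, kf w (y w.1 - Real.log M)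

/-- **The family weight is the cube log-weight of `logVec`** on totally positive `α` in the cube.
[cite: Hinz1988, §2 p. 178] -/
theorem weightΩfam_eq_Wcube [IsTotallyReal K] (kf : RP → ℝ → ℝ) {M : ℝ} (hM : 0 < M) {α : 𝓞 K} (hα : α ∈ cubeF K M) :
    weightΩfam K kf M α = (Wcube K kf M (logVec K (α : K)) : ℂ) := by
  rw [weightΩfam_eq_ofReal_prod kf hM hα]
  congr 1
  unfold Wcube
  refine Finset.prod_congr rfl fun w _ => ?_
  have hpos : 0 < remb K (α : K) w := remb_pos_of_isTotPos (isTotPos_of_mem_cubeF hα) w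
  rw [gOf_of_pos _ (div_pos hpos hM), Real.log_div hpos.ne' hM.ne']
  congr 1
  simp only [logVec]
  rw [← abs_remb, abs_of_pos hpos]

variable (K) in
/-- `Φ_t(h) = Wcube (ofTH (t, h))`: the cube weight in the `(t, h)` coordinates. [folklore] -/
def PhiT (kf : RP → ℝ → ℝ) (M t : ℝ) (h : logSpace K) : ℝ := Wcube K kf M (ofTH K (t, h))

/-- `ofTH (t, ·)` is affine: `ofTH (t, h) = ofTH (t, 0) + ofTH (0, h)`. [folklore] -/
theorem ofTH_eq_add (t : ℝ) (h : logSpace K) : ofTH K (t, h) = ofTH K (t, 0) + ofTH K (0, h) := by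
  rw [← ofTH_add]; simp

/-- `h ↦ ofTH (0, h)` is a continuous linear map. [folklore] -/
def ofTHLin : logSpace K →L[ℝ] (InfinitePlace K → ℝ) :=
  LinearMap.toContinuousLinearMap
    { toFun := fun h => ofTH K (0, h)
      map_add' := fun h h' => by rw [← ofTH_add]; simp
      map_smul' := fun c h => by
        funext w
        simp only [ofTH, Pi.smul_apply, smul_eq_mul, RingHom.id_apply]
        split_ifs with hw
        · rw [← Finset.mul_sum]; ring
        · ring }

/-- Unfolding `ofTHLin`. [folklore] -/
theorem ofTHLin_apply (h : logSpace K) : ofTHLin (K := K) h = ofTH K (0, h) := rfl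

/-- **`Φ_t` is smooth** when the profiles are. [folklore] -/
theorem contDiff_PhiT (kf : RP → ℝ → ℝ) (hk : ∀ w, ContDiff ℝ (⊤ : ℕ∞) (kf w)) (M t : ℝ) :
    ContDiff ℝ (⊤ : ℕ∞) (PhiT K kf M t) := by
  unfold PhiT Wcube
  have haff : ContDiff ℝ (⊤ : ℕ∞) (fun h : logSpace K => ofTH K (t, h)) := by
    have : (fun h : logSpace K => ofTH K (t, h)) = fun h => ofTH K (t, 0) + ofTHLin (K := K) h := by
      funext h; rw [ofTH_eq_add, ofTHLin_apply]
    rw [this]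
    exact contDiff_const.add (ofTHLin (K := K)).contDiff
  refine contDiff_prod fun w _ => (hk w).comp ?_
  exact ((contDiff_apply ℝ ℝ w.1).comp haff).sub contDiff_const

/-- **Uniform support of `Φ_t`**: if every profile vanishes off `[a − log 2, 0]` then `Φ_t(h) = 0`
whenever `‖h‖ > 2 (log 2 − a)` — independently of `t` and `M`. [folklore] -/
theorem PhiT_eq_zero_of_norm_gt [IsTotallyReal K] {kf : RP → ℝ → ℝ} {a : ℝ}
    (hlo : ∀ w v, v < a - Real.log 2 → kf w v = 0) (hhi : ∀ w v, 0 < v → kf w v = 0) (M t : ℝ) {h : logSpace K}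
    (hh : 2 * (Real.log 2 - a) < ‖h‖) : PhiT K kf M t h = 0 := by
  by_contra hne
  -- all coordinates of `y = ofTH (t,h)` lie in `[log M + a − log 2, log M]`
  set y : InfinitePlace K → ℝ := ofTH K (t, h) with hy
  have hcoord : ∀ w : InfinitePlace K, a - Real.log 2 ≤ y w - Real.log M ∧ y w - Real.log M ≤ 0 := by
    intro w
    have hw : IsReal w := IsTotallyReal.isReal w
    have hfac : kf ⟨w, hw⟩ (y w - Real.log M) ≠ 0 := by
      intro h0
      apply hne
      unfold PhiT Wcube
      exact Finset.prod_eq_zero (Finset.mem_univ ⟨w, hw⟩) h0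
    constructor
    · by_contra hlt; push Not at hlt; exact hfac (hlo _ _ hlt)
    · by_contra hlt; push Not at hlt; exact hfac (hhi _ _ hlt)
  -- hence `h = (toTH y).2` has all coordinates `≤ log 2 − a` in absolute value (real places: `mult = 1`)
  have hth : toTH K y = (t, h) := by rw [hy, toTH_ofTH]
  have hmult : ∀ w : InfinitePlace K, (mult w : ℝ) = 1 := fun w => by
    rw [mult, if_pos (IsTotallyReal.isReal w)]; norm_num
  have hd : (0 : ℝ) < d := by exact_mod_cast Module.finrank_pos
  have hT : a - Real.log 2 ≤ (∑ w, (mult w : ℝ) * y w) / d - Real.log M ∧ (∑ w, (mult w : ℝ) * y w) / d - Real.log M ≤ 0 := by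
    have hsum_lo : ∑ w : InfinitePlace K, (a - Real.log 2 + Real.log M) ≤ ∑ w, (mult w : ℝ) * y w :=
      Finset.sum_le_sum fun w _ => by rw [hmult, one_mul]; linarith [(hcoord w).1]
    have hsum_hi : ∑ w, (mult w : ℝ) * y w ≤ ∑ w : InfinitePlace K, Real.log M :=
      Finset.sum_le_sum fun w _ => by rw [hmult, one_mul]; linarith [(hcoord w).2]
    rw [Finset.sum_const, Finset.card_univ, nsmul_eq_mul] at hsum_lo hsum_hi
    have hcard : (Fintype.card (InfinitePlace K) : ℝ) = d := by
      have h1 : (d : ℝ) = ∑ w : InfinitePlace K, (mult w : ℝ) := by exact_mod_cast (sum_mult_eq (K := K)).symm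
      rw [h1, Finset.sum_congr rfl fun w _ => hmult w, Finset.sum_const, Finset.card_univ, nsmul_eq_mul, mul_one]
    rw [hcard] at hsum_lo hsum_hi
    constructor
    · rw [le_sub_iff_add_le, le_div_iff₀ hd]; linarith
    · rw [sub_nonpos, div_le_iff₀ hd]; linarith
  have hbound : ∀ w : {w : InfinitePlace K // w ≠ w₀}, |h w| ≤ Real.log 2 - a := by
    intro w
    have h1 : h w = (mult w.1 : ℝ) * (y w.1 - (∑ w', (mult w' : ℝ) * y w') / d) := by
      have := congrArg Prod.snd hth
      simp only [toTH] at this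
      exact (congrFun this w).symm
    rw [h1, hmult, one_mul, abs_le]
    constructor <;> linarith [(hcoord w.1).1, (hcoord w.1).2, hT.1, hT.2]
  have hl : 0 ≤ Real.log 2 - a := by
    obtain ⟨w⟩ := (inferInstance : Nonempty (InfinitePlace K))
    linarith [(hcoord w).1, (hcoord w).2]
  have hnorm : ‖h‖ ≤ Real.log 2 - a :=
    (pi_norm_le_iff_of_nonneg hl).2 fun w => by rw [Real.norm_eq_abs]; exact hbound w
  linarith

/-- **The unit sum of the cube weight is the periodization of `Φ_t`**: for `α ≠ 0`,
`∑'_{η ∈ U_𝔣} Wcube(logVec(ηα)) = periodize L_𝔣 (PhiT kf M t_α) h_α`. [cite: Mitsui1956, §3] -/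
theorem tsum_kerPosUnits_Wcube [IsTotallyReal K] {𝔣 : Ideal (𝓞 K)} (χ : AddChar (Additive ((𝓞 K ⧸ 𝔣)ˣ)) ℂ)
    (kf : RP → ℝ → ℝ) (M : ℝ) {α : K} (hα : α ≠ 0) :
    ∑' η : kerPosUnits χ, Wcube K kf M (logVec K ((((η : (𝓞 K)ˣ) : 𝓞 K) : K) * α)) =
      periodize (kerLattice χ) (PhiT K kf M (toTH K (logVec K α)).1) (toTH K (logVec K α)).2 :=
  tsum_kerPosUnits_eq_periodize χ (Wcube K kf M) hα

end Literature.NumberTheory.Sieve.UnitPeriodic
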